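import Literature.Geometry.Kaehler.ComplexTorusWeylOperatorPoincareSelfAdjoint
import Literature.Algebra.Lie.LefschetzModuleSelfAdjoint
import HarnessLib

/-!
# `*_L` and Kleiman–Milne's `∗` are SELF-ADJOINT for the cup-product pairing of a complex torus, and isometries of it
# (André 1996, §1.1: "`L`, `*_L`, `*_H` et `ᶜΛ` sont auto-adjoints relativement à l'accouplement de dualité de Poincaré")

Layer `Literature/Geometry/Kaehler`, namespace `Literature.Geometry.Kaehler.ComplexTorus`; lane `lit-hodgefound` (Track 2 foundations library),
prover seat `lit-hodgefound-p35` (generation 50, row g50-#5 of the programme «the Hodge star, the Weil operator and the Weyl element on the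
Hodge–Lefschetz bigrading of a complex torus»). THEOREMS ONLY (no definition, no named fact, no instance, no notation; D-0026 net debt `0`).
It reads the ABSTRACT row g30-#3 of p34 (`Algebra/Lie/LefschetzModuleSelfAdjoint`: for a bilinear form `B` with `h` skew-adjoint and `e`
self-adjoint, `*_L = lefschetzInvolution`, Kleiman's `⋆ = hodgeInvolution` and `*_L e *_L` are `B`-self-adjoint: `isSelfAdjoint_lefschetzInvolution`,
`isSelfAdjoint_hodgeInvolution`, `isSelfAdjoint_conj_lefschetzInvolution`) on the torus-forms carrier, exactly as p09's row g52-#3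
`ComplexTorusWeylOperatorPoincareSelfAdjoint` read `isSelfAdjoint_dual` / `isSelfAdjoint_weylOperator` there (`⟨Λ_η x, y⟩ = ⟨x, Λ_η y⟩`,
`⟨w(x), y⟩ = ⟨x, w(y)⟩` — consumed: `poincarePairing_lefschetzPow_one_comm`, `poincarePairing_countingG_skew`; its graded pairing is private
there and is re-assembled privately here by the same recipe). André's list "`L`, `*_L`, `*_H`, `ᶜΛ`" on the torus is thereby COMPLETE:
`L` and `ᶜΛ` and `w = ±(j!/r!)∗` are p09's g52-#3, André's rescaled `*_H` is p35's g49-#3 (`torusIntegral_andreHodgeInvolution_of_wedge_comm`),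
`*_L` and Kleiman–Milne's `∗` are THIS file.

SETTING. `X = E/Φ(ℤ^ι)` a complex torus, `g = dim_ℂ E` (`hg : finrank ℂ E = g` where a name is needed), `e : Fin N ≃ ι` a lattice frame (`N = 2g`),
`⟨x, y⟩_e = poincarePairing Φ e h x y = (x ∧ y)(λ_{e(1)}, …, λ_{e(N)})` the cup-product pairing of complementary degrees `k + m = N`
(`ComplexTorusPoincareDuality`), `η` a non-degenerate real `2`-form (`hη`), `*_L = (hasLefschetzProperty_lefschetzG hη).lefschetzInvolution isZGrading_countingG`,
`∗ = (hasLefschetzProperty_lefschetzG hη).hodgeInvolution isZGrading_countingG g` on `H•(X; ℂ) = GForm E ℂ`, read componentwise: `*_L(x)_m = (*_L (of k x)) m ∈ Hᵐ`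
for `x ∈ Hᵏ`, `k + m = 2g` (the only non-zero component, `lefschetzInvolution_of_eq_of`).

## Source, VERBATIM (held `paper:doi-10-1007-bf02698643`)

Y. André, *Pour une théorie inconditionnelle des motifs*, Publ. Math. IHÉS 83 (1996) [Andre1996Motifs], §1.1 (p. 11 = chunk p0008 L11–L14):
"On voit immédiatement que `Pʲ(X) = Hʲ(X) ∩ Ker *_L L *_L` et que l'opérateur `*_L L *_L […]`, proportionnel à `ᶜΛ` sur chaque composante de
Lefschetz, est un inverse à droite de `L` sur l'image de `L`. Remarquons aussi que `L`, `*_L`, `*_H` et `ᶜΛ` sont auto-adjoints relativement à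
l'accouplement de dualité de Poincaré `(x, y) ↦ ∫ x ∪ y`."; Prop. 1.2 (p. 11 = p0008 L62–L66): "la transposition relative à la forme
bilinéaire `(x, y) ↦ ∫ x ∪ * y` correspond à la transposition des matrices, pour `* = *_L` ou `*_H`". J. S. Milne, *Lefschetz classes on abelian
varieties* (1999) [Milne1999LefschetzClasses], `paper:doi-10-1215-s0012-7094-99-09620-5` p0026 L55–L70 (the operator `∗`; Thm. 5.9).
H. Lange, *Abelian Varieties over the Complex Numbers* (2023) [Lange2023AbelianVarietiesComplex], §1.4.1 (p. 37: the cup product on `H•(X, ℂ) = ⋀• Hom`).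

## What is proved

* §0 `lefschetzInvolution_of_eq_of`, `hodgeInvolution_of_eq_of` (`*_L`, `∗ : Hᵏ → H^{2g-k}` componentwise — homogeneity, from p34's
  `lefschetzInvolution_apply_mem` / `hodgeInvolution_apply_mem`).
* §1 **`poincarePairing_lefschetzInvolution_comm`: `⟨*_L(x), y⟩ = ⟨x, *_L(y)⟩` for all `x, y ∈ Hᵏ(X; ℂ)`** and EVERY non-degenerate `η`
  ("`*_L` […] auto-adjoint"), **`poincarePairing_lefschetzInvolution_lefschetzInvolution`: `⟨*_L(x), *_L(y)⟩ = ⟨x, y⟩`** for `x ∈ Hᵏ`, `y ∈ H^{2g-k}`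
  (`*_L` IS AN ISOMETRY of the cup-product pairing: self-adjoint and `*_L² = 1`), `poincarePairing_conj_lefschetzInvolution_comm`
  (`*_L L *_L`, André's `ᶜL`, is self-adjoint).
* §2 **`poincarePairing_hodgeInvolution_comm`: `⟨∗x, y⟩ = ⟨x, ∗y⟩`** (Kleiman–Milne's `∗`, a Lefschetz correspondence on abelian varieties — Milne's
  Thm. 5.9 — is self-adjoint for the cup product) and **`poincarePairing_hodgeInvolution_hodgeInvolution`: `⟨∗x, ∗y⟩ = ⟨x, y⟩`** (`∗² = 1`).

## Scope / not here

`L_η`, `Λ_η`, `w`: p09's row g52-#3; André's `*_H` with its factor `k!/(d-j+k)!`: p35's row g49-#3; the "transposition des matrices" clause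
of Prop. 1.2 is p34's abstract `isAdjointPair_compl₂_lefschetzInvolution` / p35's row g49-#1 and is not re-read here. No definition is
introduced (the graded pairing lives inside the proofs).
-/

noncomputable section

-- `Module ℂ` / `SMulZeroClass ℂ` synthesis on `E [⋀^Fin k]→L[ℝ] ℂ` (as in `ComplexTorusLefschetzDecomposition`)
set_option maxSynthPendingDepth 3

namespace Literature.Geometry.Kaehler

namespace ComplexTorus

open Module Function Finset
open Literature.LinearAlgebra.Alternating Literature.Algebra.Lie

universe uE

variable {ι : Type*} [Fintype ι] [DecidableEq ι] {E : Type uE} [NormedAddCommGroup E] [NormedSpace ℂ E] [FiniteDimensional ℂ E]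
  [Nontrivial E] (Φ : (ι → ℝ) ≃L[ℝ] E) {η : E [⋀^Fin 2]→L[ℝ] ℝ} {N : ℕ}

/-! ## §0 Homogeneity of `*_L` and `∗`; the graded cup-product pairing (private) -/

section Homog

omit [Fintype ι] [DecidableEq ι] in
/-- **`*_L : Hᵏ(X; ℂ) → H^{2g-k}(X; ℂ)`**: `*_L(of k x)` is homogeneous of degree `m`, `k + m = 2g` (`*_L` maps the `h`-weight space `M_{k-g}` to
`M_{g-k}`, p34's `lefschetzInvolution_apply_mem`). [cite: Andre1996Motifs, §1.1 (p. 10, "`*_L x = Σ L^{d-j+k} x_{j-2k}`")] -/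
theorem lefschetzInvolution_of_eq_of (hη : ∀ v : E, v ≠ 0 → ∃ w : E, η ![v, w] ≠ 0) {k m : ℕ} (h : k + m = 2 * finrank ℂ E)
    (x : E [⋀^Fin k]→L[ℝ] ℂ) :
    (hasLefschetzProperty_lefschetzG hη).lefschetzInvolution isZGrading_countingG (GForm.of k x) =
      GForm.of m ((hasLefschetzProperty_lefschetzG hη).lefschetzInvolution isZGrading_countingG (GForm.of k x) m) := by
  have h1 := (hasLefschetzProperty_lefschetzG hη).lefschetzInvolution_apply_mem isZGrading_countingG (of_mem_degreeSpace_countingG (E := E) k x)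
  rw [show -((k : ℤ) - (finrank ℂ E : ℤ)) = (m : ℤ) - (finrank ℂ E : ℤ) by omega] at h1
  exact (mem_degreeSpace_countingG_iff.1 h1).eq_of

omit [Fintype ι] [DecidableEq ι] in
/-- **`∗ : Hᵏ(X; ℂ) → H^{2g-k}(X; ℂ)`**: Kleiman–Milne's `∗(of k x)` is homogeneous of degree `m`, `k + m = 2g` (p34's `hodgeInvolution_apply_mem`).
[cite: Milne1999LefschetzClasses, §5 p. 664 ("`∗x = Σ (-1)^{…} L^{d-s+i} xᵢ`")] -/
theorem hodgeInvolution_of_eq_of (hη : ∀ v : E, v ≠ 0 → ∃ w : E, η ![v, w] ≠ 0) (d : ℕ) {k m : ℕ} (h : k + m = 2 * finrank ℂ E)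
    (x : E [⋀^Fin k]→L[ℝ] ℂ) :
    (hasLefschetzProperty_lefschetzG hη).hodgeInvolution isZGrading_countingG d (GForm.of k x) =
      GForm.of m ((hasLefschetzProperty_lefschetzG hη).hodgeInvolution isZGrading_countingG d (GForm.of k x) m) := by
  have h1 := (hasLefschetzProperty_lefschetzG hη).hodgeInvolution_apply_mem isZGrading_countingG d (of_mem_degreeSpace_countingG (E := E) k x)
  rw [show -((k : ℤ) - (finrank ℂ E : ℤ)) = (m : ℤ) - (finrank ℂ E : ℤ) by omega] at h1
  exact (mem_degreeSpace_countingG_iff.1 h1).eq_of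

omit [Fintype ι] [FiniteDimensional ℂ E] [Nontrivial E] in
/-- The graded cup-product pairing `B(w, w') = Σ_{k+l=N} ⟨w_k, w'_l⟩_e` on `H•(X; ℂ)` (a private re-assembly of the packaging of row g52-#3, whose
copy is private there). [cite: Andre1996Motifs, §1.1 (p. 11, "(x, y) ↦ ∫ x ∪ y")] [cite: Lange2023AbelianVarietiesComplex, §1.4.1 (p. 37)] -/
private theorem exists_gradedPairing₆₅ (e : Fin N ≃ ι) :
    ∃ B : LinearMap.BilinForm ℂ (GForm E ℂ),
      (∀ (k l : ℕ) (h : k + l = N) (x : E [⋀^Fin k]→L[ℝ] ℂ) (y : E [⋀^Fin l]→L[ℝ] ℂ),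
          B (GForm.of k x) (GForm.of l y) = poincarePairing Φ e h x y) ∧
      (∀ (k l : ℕ), k + l ≠ N → ∀ (x : E [⋀^Fin k]→L[ℝ] ℂ) (y : E [⋀^Fin l]→L[ℝ] ℂ), B (GForm.of k x) (GForm.of l y) = 0) := by
  classical
  refine ⟨∑ k ∈ Finset.range (N + 1), ∑ l ∈ Finset.range (N + 1),
    if h : k + l = N then (poincarePairing Φ e h).compl₁₂ (LinearMap.proj (R := ℂ) (φ := fun m ↦ E [⋀^Fin m]→L[ℝ] ℂ) k)
      (LinearMap.proj (R := ℂ) (φ := fun m ↦ E [⋀^Fin m]→L[ℝ] ℂ) l) else 0, fun k l h x y ↦ ?_, fun k l hkl x y ↦ ?_⟩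
  · simp only [LinearMap.sum_apply]
    rw [Finset.sum_eq_single_of_mem k (Finset.mem_range.2 (by omega)) fun k' _ hk' ↦ ?_]
    · rw [Finset.sum_eq_single_of_mem l (Finset.mem_range.2 (by omega)) fun l' _ hl' ↦ ?_]
      · rw [dif_pos h, LinearMap.compl₁₂_apply, LinearMap.proj_apply, LinearMap.proj_apply, GForm.of_apply_self, GForm.of_apply_self]
      · split_ifs with h'
        · rw [LinearMap.compl₁₂_apply, LinearMap.proj_apply, LinearMap.proj_apply, GForm.of_apply_of_ne hl', map_zero]
        · rw [LinearMap.zero_apply, LinearMap.zero_apply]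
    · refine Finset.sum_eq_zero fun l' _ ↦ ?_
      split_ifs with h'
      · rw [LinearMap.compl₁₂_apply, LinearMap.proj_apply, LinearMap.proj_apply, GForm.of_apply_of_ne hk', map_zero, LinearMap.zero_apply]
      · rw [LinearMap.zero_apply, LinearMap.zero_apply]
  · simp only [LinearMap.sum_apply]
    refine Finset.sum_eq_zero fun k' _ ↦ Finset.sum_eq_zero fun l' _ ↦ ?_
    split_ifs with h'
    · rw [LinearMap.compl₁₂_apply, LinearMap.proj_apply, LinearMap.proj_apply]
      by_cases hk' : k' = k
      · subst hk'
        have hl' : l' ≠ l := fun hll ↦ hkl (hll ▸ h')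
        rw [GForm.of_apply_of_ne hl', map_zero]
      · rw [GForm.of_apply_of_ne hk', map_zero, LinearMap.zero_apply]
    · rw [LinearMap.zero_apply, LinearMap.zero_apply]

omit [Fintype ι] [DecidableEq ι] [Nontrivial E] in
/-- An adjoint pair is detected on homogeneous elements. [folklore] -/
private theorem isAdjointPair_of_forall_of₆₅ {B : LinearMap.BilinForm ℂ (GForm E ℂ)} {S T : Module.End ℂ (GForm E ℂ)}
    (hST : ∀ (a b : ℕ) (x : E [⋀^Fin a]→L[ℝ] ℂ) (y : E [⋀^Fin b]→L[ℝ] ℂ),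
      B (S (GForm.of a x)) (GForm.of b y) = B (GForm.of a x) (T (GForm.of b y))) :
    LinearMap.IsAdjointPair B B S T := by
  intro w w'
  conv_lhs => rw [← sum_range_of_eq w, ← sum_range_of_eq w']
  conv_rhs => rw [← sum_range_of_eq w, ← sum_range_of_eq w']
  simp only [map_sum, LinearMap.sum_apply, hST]

omit [Nontrivial E] in
/-- The graded pairing with `H` skew-adjoint and `L_η` self-adjoint (private packaging; the two adjointness facts are row g52-#3's public
`poincarePairing_countingG_skew`, `poincarePairing_lefschetzPow_one_comm`). [cite: Andre1996Motifs, §1.1 (p. 11)] -/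
private theorem exists_gradedPairing_skew_self₆₅ (η : E [⋀^Fin 2]→L[ℝ] ℝ) (e : Fin N ≃ ι) :
    ∃ B : LinearMap.BilinForm ℂ (GForm E ℂ),
      (∀ (k l : ℕ) (h : k + l = N) (x : E [⋀^Fin k]→L[ℝ] ℂ) (y : E [⋀^Fin l]→L[ℝ] ℂ),
          B (GForm.of k x) (GForm.of l y) = poincarePairing Φ e h x y) ∧
      B.IsSkewAdjoint (countingG E) ∧ B.IsSelfAdjoint (lefschetzG η) := by
  obtain ⟨B, hB, hB0⟩ := exists_gradedPairing₆₅ Φ e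
  refine ⟨B, hB, ?_, ?_⟩
  · change LinearMap.IsAdjointPair B B ⇑(countingG E) ⇑(-countingG E)
    refine isAdjointPair_of_forall_of₆₅ fun a b x y ↦ ?_
    rw [countingG_of, LinearMap.neg_apply, countingG_of, map_neg, ← GForm.of_smul, ← GForm.of_smul]
    by_cases h : a + b = N
    · rw [hB a b h, hB a b h, poincarePairing_countingG_skew Φ e h]
    · rw [hB0 a b h, hB0 a b h, neg_zero]
  · refine isAdjointPair_of_forall_of₆₅ fun a b x y ↦ ?_
    rw [lefschetzG_of, lefschetzG_of]
    by_cases h : (a + 2) + b = N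
    · rw [hB _ _ h, hB _ _ (show a + (b + 2) = N by omega), poincarePairing_lefschetzPow_one_comm Φ η e h (by omega)]
    · rw [hB0 _ _ h, hB0 _ _ (show a + (b + 2) ≠ N by omega)]

end Homog

/-! ## §1 `*_L` is self-adjoint for the cup-product pairing, and an isometry of it -/

section LefschetzInvolution

/-- **"`*_L` […] auto-adjoint relativement à l'accouplement de dualité de Poincaré": `⟨*_L(x), y⟩ = ⟨x, *_L(y)⟩` for all `x, y ∈ Hᵏ(X; ℂ)`**,
every non-degenerate real `2`-form `η` on a complex torus of any dimension (`*_L(x) = (*_L (of k x))_m ∈ Hᵐ`, `k + m = 2g`): p34's abstract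
`isSelfAdjoint_lefschetzInvolution` (on matched strings both sides equal `⟨eᵏ p, p'⟩`, unmatched strings are orthogonal) read through the graded
cup-product pairing, in which `H` is skew-adjoint and `L_η` self-adjoint (row g52-#3). [cite: Andre1996Motifs, §1.1 (p. 11, "`L`, `*_L`, `*_H` et `ᶜΛ` sont auto-adjoints")] -/
theorem poincarePairing_lefschetzInvolution_comm (hη : ∀ v : E, v ≠ 0 → ∃ w : E, η ![v, w] ≠ 0) (e : Fin N ≃ ι) {k m : ℕ}
    (h₁ : m + k = N) (h₂ : k + m = N) (x y : E [⋀^Fin k]→L[ℝ] ℂ) :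
    poincarePairing Φ e h₁ ((hasLefschetzProperty_lefschetzG hη).lefschetzInvolution isZGrading_countingG (GForm.of k x) m) y =
      poincarePairing Φ e h₂ x ((hasLefschetzProperty_lefschetzG hη).lefschetzInvolution isZGrading_countingG (GForm.of k y) m) := by
  obtain ⟨B, hB, hh, he⟩ := exists_gradedPairing_skew_self₆₅ Φ η e
  have hN := finrank_complex_mul_two Φ e
  have key := (hasLefschetzProperty_lefschetzG hη).isSelfAdjoint_lefschetzInvolution isZGrading_countingG hh he (GForm.of k x) (GForm.of k y)
  rwa [lefschetzInvolution_of_eq_of hη (show k + m = 2 * finrank ℂ E by omega) x,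
    lefschetzInvolution_of_eq_of hη (show k + m = 2 * finrank ℂ E by omega) y, hB _ _ h₁, hB _ _ h₂] at key

/-- **`*_L` IS AN ISOMETRY OF THE CUP-PRODUCT PAIRING: `⟨*_L(x), *_L(y)⟩ = ⟨x, y⟩`** for `x ∈ Hᵏ(X; ℂ)`, `y ∈ Hᵐ(X; ℂ)`, `k + m = 2g`
(`*_L(x) ∈ Hᵐ`, `*_L(y) ∈ Hᵏ`): self-adjointness and `*_L ∘ *_L = 1` ("les involutions de Lefschetz", p34's `lefschetzInvolution_mul_self`).
[cite: Andre1996Motifs, §1.1 (p. 10, "involutions"; p. 11, "auto-adjoints")] -/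
theorem poincarePairing_lefschetzInvolution_lefschetzInvolution (hη : ∀ v : E, v ≠ 0 → ∃ w : E, η ![v, w] ≠ 0) (e : Fin N ≃ ι)
    {k m : ℕ} (h₁ : m + k = N) (h₂ : k + m = N) (x : E [⋀^Fin k]→L[ℝ] ℂ) (y : E [⋀^Fin m]→L[ℝ] ℂ) :
    poincarePairing Φ e h₁ ((hasLefschetzProperty_lefschetzG hη).lefschetzInvolution isZGrading_countingG (GForm.of k x) m)
        ((hasLefschetzProperty_lefschetzG hη).lefschetzInvolution isZGrading_countingG (GForm.of m y) k) =
      poincarePairing Φ e h₂ x y := by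
  obtain ⟨B, hB, hh, he⟩ := exists_gradedPairing_skew_self₆₅ Φ η e
  have hN := finrank_complex_mul_two Φ e
  set L := hasLefschetzProperty_lefschetzG hη with hL
  have key := L.isSelfAdjoint_lefschetzInvolution isZGrading_countingG hh he (GForm.of k x) (L.lefschetzInvolution isZGrading_countingG (GForm.of m y))
  rw [L.lefschetzInvolution_lefschetzInvolution isZGrading_countingG, lefschetzInvolution_of_eq_of hη (show k + m = 2 * finrank ℂ E by omega) x,
    lefschetzInvolution_of_eq_of hη (show m + k = 2 * finrank ℂ E by omega) y, hB _ _ h₁, hB _ _ h₂] at key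
  exact key

/-- **André's `ᶜL = *_L L_η *_L` is self-adjoint: `⟨ᶜL(x), y⟩ = ⟨x, ᶜL(y)⟩`** for `x ∈ H^{a+2}(X; ℂ)`, `y ∈ H^{b+2}(X; ℂ)`, `a + b + 2 = 2g` (`ᶜL` lowers
the degree by `2`; "l'opérateur `*_L L *_L`, proportionnel à `ᶜΛ` sur chaque composante de Lefschetz"). [cite: Andre1996Motifs, §1.1 (p. 11)] -/
theorem poincarePairing_conj_lefschetzInvolution_comm (hη : ∀ v : E, v ≠ 0 → ∃ w : E, η ![v, w] ≠ 0) (e : Fin N ≃ ι) {a b : ℕ}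
    (h₁ : a + (b + 2) = N) (h₂ : (a + 2) + b = N) (x : E [⋀^Fin (a + 2)]→L[ℝ] ℂ) (y : E [⋀^Fin (b + 2)]→L[ℝ] ℂ) :
    poincarePairing Φ e h₁ (((hasLefschetzProperty_lefschetzG hη).lefschetzInvolution isZGrading_countingG * lefschetzG η *
        (hasLefschetzProperty_lefschetzG hη).lefschetzInvolution isZGrading_countingG) (GForm.of (a + 2) x) a) y =
      poincarePairing Φ e h₂ x (((hasLefschetzProperty_lefschetzG hη).lefschetzInvolution isZGrading_countingG * lefschetzG η *
        (hasLefschetzProperty_lefschetzG hη).lefschetzInvolution isZGrading_countingG) (GForm.of (b + 2) y) b) := by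
  obtain ⟨B, hB, hh, he⟩ := exists_gradedPairing_skew_self₆₅ Φ η e
  have hN := finrank_complex_mul_two Φ e
  set L := hasLefschetzProperty_lefschetzG hη with hL
  -- `ᶜL(of (c+2) z) = of c (ᶜL(of (c+2) z) c)`: three homogeneous steps
  have hom : ∀ {c d : ℕ} (hcd : (c + 2) + d = 2 * finrank ℂ E) (z : E [⋀^Fin (c + 2)]→L[ℝ] ℂ),
      (L.lefschetzInvolution isZGrading_countingG * lefschetzG η * L.lefschetzInvolution isZGrading_countingG) (GForm.of (c + 2) z) =
        GForm.of c ((L.lefschetzInvolution isZGrading_countingG * lefschetzG η * L.lefschetzInvolution isZGrading_countingG)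
          (GForm.of (c + 2) z) c) := by
    intro c d hcd z
    have h3 : (L.lefschetzInvolution isZGrading_countingG * lefschetzG η * L.lefschetzInvolution isZGrading_countingG) (GForm.of (c + 2) z) =
        GForm.of c (L.lefschetzInvolution isZGrading_countingG (GForm.of (d + 2) (lefschetzPow η 1 (by omega)
          (L.lefschetzInvolution isZGrading_countingG (GForm.of (c + 2) z) d))) c) := by
      rw [Module.End.mul_apply, Module.End.mul_apply, lefschetzInvolution_of_eq_of hη hcd z, lefschetzG_of,
        lefschetzInvolution_of_eq_of hη (show (d + 2) + c = 2 * finrank ℂ E by omega), GForm.of_apply_self]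
    rw [h3, GForm.of_apply_self]
  have key := L.isSelfAdjoint_conj_lefschetzInvolution isZGrading_countingG hh he (GForm.of (a + 2) x) (GForm.of (b + 2) y)
  rw [hom (show (a + 2) + b = 2 * finrank ℂ E by omega) x, hom (show (b + 2) + a = 2 * finrank ℂ E by omega) y, hB _ _ h₁, hB _ _ h₂] at key
  exact key

end LefschetzInvolution

/-! ## §2 Kleiman–Milne's `∗` is self-adjoint for the cup-product pairing, and an isometry of it -/

section HodgeInvolution

/-- **`⟨∗x, y⟩ = ⟨x, ∗y⟩` for all `x, y ∈ Hᵏ(X; ℂ)`**: Kleiman–Milne's combinatorial star `∗ = hodgeInvolution … d` (`∗(Lʲχ) = (-1)^{(d-n)(d-n+1)/2} Lʳχ`;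
Milne's Thm. 5.9: on an abelian variety `∗` is a Lefschetz correspondence) is self-adjoint for the cup product, for every non-degenerate `η` and every
normalisation `d` (p34's abstract `isSelfAdjoint_hodgeInvolution`: on matched strings the two signs agree). [cite: Andre1996Motifs, §1.1 (p. 11, "`*_H` […] auto-adjoint")]
[cite: Milne1999LefschetzClasses, §5 p. 664, Thm. 5.9 (p0026 L55–L70)] -/
theorem poincarePairing_hodgeInvolution_comm (hη : ∀ v : E, v ≠ 0 → ∃ w : E, η ![v, w] ≠ 0) (e : Fin N ≃ ι) (d : ℕ) {k m : ℕ}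
    (h₁ : m + k = N) (h₂ : k + m = N) (x y : E [⋀^Fin k]→L[ℝ] ℂ) :
    poincarePairing Φ e h₁ ((hasLefschetzProperty_lefschetzG hη).hodgeInvolution isZGrading_countingG d (GForm.of k x) m) y =
      poincarePairing Φ e h₂ x ((hasLefschetzProperty_lefschetzG hη).hodgeInvolution isZGrading_countingG d (GForm.of k y) m) := by
  obtain ⟨B, hB, hh, he⟩ := exists_gradedPairing_skew_self₆₅ Φ η e
  have hN := finrank_complex_mul_two Φ e
  have key := (hasLefschetzProperty_lefschetzG hη).isSelfAdjoint_hodgeInvolution isZGrading_countingG d hh he (GForm.of k x) (GForm.of k y)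
  rwa [hodgeInvolution_of_eq_of hη d (show k + m = 2 * finrank ℂ E by omega) x,
    hodgeInvolution_of_eq_of hη d (show k + m = 2 * finrank ℂ E by omega) y, hB _ _ h₁, hB _ _ h₂] at key

/-- **`∗` IS AN ISOMETRY OF THE CUP-PRODUCT PAIRING: `⟨∗x, ∗y⟩ = ⟨x, y⟩`** for `x ∈ Hᵏ(X; ℂ)`, `y ∈ Hᵐ(X; ℂ)`, `k + m = 2g` (self-adjointness and
`∗ ∘ ∗ = 1`, p34's `hodgeInvolution_hodgeInvolution`). [cite: Milne1999LefschetzClasses, §5 p. 664] [cite: Andre1996Motifs, §1.1 (pp. 10–11)] -/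
theorem poincarePairing_hodgeInvolution_hodgeInvolution (hη : ∀ v : E, v ≠ 0 → ∃ w : E, η ![v, w] ≠ 0) (e : Fin N ≃ ι) (d : ℕ)
    {k m : ℕ} (h₁ : m + k = N) (h₂ : k + m = N) (x : E [⋀^Fin k]→L[ℝ] ℂ) (y : E [⋀^Fin m]→L[ℝ] ℂ) :
    poincarePairing Φ e h₁ ((hasLefschetzProperty_lefschetzG hη).hodgeInvolution isZGrading_countingG d (GForm.of k x) m)
        ((hasLefschetzProperty_lefschetzG hη).hodgeInvolution isZGrading_countingG d (GForm.of m y) k) =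
      poincarePairing Φ e h₂ x y := by
  obtain ⟨B, hB, hh, he⟩ := exists_gradedPairing_skew_self₆₅ Φ η e
  have hN := finrank_complex_mul_two Φ e
  set L := hasLefschetzProperty_lefschetzG hη with hL
  have key := L.isSelfAdjoint_hodgeInvolution isZGrading_countingG d hh he (GForm.of k x)
    (L.hodgeInvolution isZGrading_countingG d (GForm.of m y))
  rw [L.hodgeInvolution_hodgeInvolution isZGrading_countingG d, hodgeInvolution_of_eq_of hη d (show k + m = 2 * finrank ℂ E by omega) x,
    hodgeInvolution_of_eq_of hη d (show m + k = 2 * finrank ℂ E by omega) y, hB _ _ h₁, hB _ _ h₂] at key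
  exact key

end HodgeInvolution

end ComplexTorus

end Literature.Geometry.Kaehler

end
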